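import Literature.MathematicalPhysics.QuantumFieldTheory.Balaban1983to89.B3Eq121LabelledChains
import Literature.MathematicalPhysics.QuantumFieldTheory.Balaban1983to89.B3Eq121OnePIChains

/-!
# `Balaban1983to89.B3Eq121LabelledDyson` — T. Bałaban, *(Higgs)₂,₃ quantum fields in a finite volume. III.
# Renormalization*, Commun. Math. Phys. **88** (1983) 411–445 [Balaban1983Higgs3], (1.21) p. 416 — THE DYSON EQUATION
# `Eq121` AND THE PRINTED SERIES `G = Σₙ C₀[XC₀]ⁿ` FOR THE LABELLED GAUSSIAN PERTURBATION EXPANSION, `X :=` THE GENERATING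
# SERIES OF THE LABELLED AMPUTATED ONE-PARTICLE-IRREDUCIBLE GRAPHS (BRICK 9, FILE 3 of «amputation / 1PI / Dyson
# resummation FROM (1.19)» on the labelled carrier of BRICK 5)

statement-level skeleton of published theorems with citation tags; proofs where landed; nothing here is a claim about
the Yang–Mills mass gap

PDF held: `paper:balaban1983-higgs-2-3-quantum-fields-finite-volume` (journal page = PDF page + 410); p. 416 (PDF 6) L12–21 and
p. 414 (PDF 4) L38–43 read in the text layer this session.

CITATION HEADER (lean-in-tree rule).  Part of the lit-balaban TYPED SKELETON (HOME `run/shared/lean/pub/lit-balaban/`),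
Phase 2, proof seat p33 (gen 73, unit `lit-balaban-p33`; TAKING HOME/STATUS.md 2026-08-23T17:00:23Z, owner r15 g16 «WELCOME —
PRIORITY YOURS» 17:02:01Z); row **B3.Eq1.19-1.22** of `HOME/lit-balaban-r15/ROWS-B3.md` (fold owner r15, referee ref-4; head
`proved`, HEAD WORDS Q25/Q28/Q28′ — this file is an OPTIONAL located member, zero head weight).  WHAT IS REPRODUCED: the
third step of «amputation / 1PI / Dyson resummation FROM (1.19)»: from FILE 2's colour-summed last-block recursion
(`B3Eq121LabelledChains.VertexData.AMat_eq`, indexed by vertex SUBSETS) to (1.21) in r15's and p32's vocabulary BY NAME —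
r15's `B3Sect1TwoPoint.Eq121 G C₀ X` (`G = C₀ + G·X·C₀`) and `B3Sect1TwoPoint.dysonTerm`, p32's
`B3Eq121OnePIChains.sigmaSeries` / `greenSeries` / `eq_greenSeries_of_eq121` / `coeff_greenSeries_eq_sum_dysonTerm` /
`greenSeries_eq_tsum_dysonTerm` — with `ι := OnePIGraph`, THE LABELLED COLOURED AMPUTATED 1PI TWO-POINT GRAPHS of the
expansion, `X = 𝕂(t) = sigmaSeries gAmp gDeg` and `G(t) = C + C·𝔸(t)·C = greenSeries C gAmp gDeg = Σ'ₙ C[XC]ⁿ`.  FILE 4 (next):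
the instance on BRICK 5's `HiggsLattice` carrier at `e = 0` (`B3Eq119ConnectedGraphs.iteratedDerivWithin_twoPointFamily_eq_sum_connected`:
`n!·coeffₙ G(t)` = the `n`-th `t`-derivative of the two-point function).  USED BY NAME, nothing re-declared: FILE 1
(`legsOf`, `kerSet`, `kerSum`), FILE 2 (`posMat`, `posVec`, `kerMat`, `ampMat_congr`/`ampMat_map`/`kerMat_congr`/`kerMat_map`,
`pw`/`pw_map`, `VertexData` with `act`/`lposOf`/`col`/`coefOf`/`mem_col`, `ampMatZ`/`kerMatZ`/`AMat`/`KMat`, `AMat_eq`), r15's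
`Eq121`/`dysonTerm`, p32's series and theorems above, Mathlib's `Function.extend`, `Finset.sum_powerset_apply_card`,
`Finset.card_univ_sdiff`, `Nat.cast_choose`, `Finset.Nat.sum_antidiagonal_eq_sum_range_succ`, `PowerSeries.coeff_def`,
`Finsupp.degree_single`, `PowerSeries.WithPiTopology`.  DISJOINT from p32/p37's model-graph chain files as carriers (p32's
ABSTRACT series API is instantiated, no dictionary to `B3TwoPointGraphs` model graphs is claimed: «none yet»).

THE PRINT (verbatim, p. 416): «The function G^ε has a perturbative expansion of the following structure
G^ε = Σ_{n=0}^∞ C^ε_0[(−δm² + Σ^ε + ∂^{ε*}Σ^ε_1 + Σ^{ε*}_1∂^ε + ∂^{ε*}Σ^ε_2∂^ε)C^ε_0]ⁿ, (1.21) where C^ε_0 = (−Δ^ε_0 + m²)^{−1} and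
Σ^ε, Σ^ε_1, Σ^ε_2 are given by amputated, one-particle-irreducible graphs of the expansion of G^ε. Here we have a graphical
description of the same type as in (1.17) … (of course internal indices and vector indices are understood here).»

THE ARGUMENT (ours).  §6 RELABELLING: along an embedding `ψ : W ↪ W'` of vertex types a colouring extends by the spare colour
(`extendCol` = `Function.extend`), colourings of `U` and of `ψ(U)` correspond (`extendCol_mem_col`, `comp_mem_col`,
`extendCol_comp`), active legs / positions / pair weights are transported (`mem_act_extendCol_iff`, `lposOf_extendCol`, FILE 2's
`ampMat_congr` + `ampMat_map` + `pw_map`), so `𝔸(ψ(U)) = 𝔸(U)`, `𝕂(ψ(U)) = 𝕂(U)` (**`AMat_map`**, **`KMat_map`**).  §7 ON `n`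
LABELLED VERTICES: `𝔸ₙ := 𝔸(Fin n)`, `𝕂ₙ := 𝕂(Fin n)` (`ANat`, `KNat`); `𝔸(U) = 𝔸_{|U|}` (enumerate `U`, `AMat_eq_ANat_card`);
`𝔸₀ = 𝕂₀ = 0` (no legs); FILE 2's subset recursion on `Fin n` with `|Fin n ∖ B| = n − |B|` and `Finset.sum_powerset_apply_card`
gives the BINOMIAL recursion **`ANat_eq`**: `𝔸ₙ = 𝕂ₙ + Σ_{j ≤ n} C(n,j)·𝔸_{n−j}·C·𝕂_j`.  §8 EXPONENTIAL GENERATING FUNCTIONS over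
`[Algebra ℚ R]`: `𝔸(t) := Σₙ tⁿ/n!·𝔸ₙ`, `𝕂(t)`, `G(t) := C + C·𝔸(t)·C` in `PowerSeries (Matrix S S R)` (`aSer`, `kSer`, `gSer`);
`1/n!·C(n,j) = 1/(n−j)!·1/j!` turns `ANat_eq` into the CHAIN EQUATION **`aSer_eq`**: `𝔸(t) = 𝕂(t) + 𝔸(t)·C·𝕂(t)`, whence
**`eq121_gSer`**: `Eq121 G(t) (C C) 𝕂(t)` (`noncomm_ring`), and the coefficients **`coeff_gSer`**: `coeff₀ G = C`,
`n!·coeffₙ G = C·𝔸ₙ·C` (`factorial_smul_coeff_gSer`).  §8′ p32 BY NAME: `legMat` = the value of ONE labelled graph at the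
positions of its external legs, `kerMat = Σ_{graphs} legMat` (`kerMat_eq_sum_legMat`); `kerIdx n` = the finite set of labelled
coloured 1PI graphs `(z; a, e, μ)` on `Fin n`, `OnePIGraph := Σ n, kerIdx n`, `gDeg = n`, `gAmp = 1/n!·coef(z)·legMat` ; every
graph has `n ≥ 1` (`gDeg_ne_zero`: no vertex, no leg) and each order is finite (`finite_gDeg_eq`), `Σ_{order m} gAmp = 𝕂ₘ/m!`
(`sum_kerIdx_gAmp`), so **`kSer_eq_sigmaSeries`**: `𝕂(t) = sigmaSeries gAmp gDeg`; p32's uniqueness `eq_greenSeries_of_eq121`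
gives **`gSer_eq_greenSeries`**, and p32's order-by-order / `tsum` forms give **`coeff_gSer_eq_sum_dysonTerm`**:
`coeffₘ G = Σ_{n ≤ m} coeffₘ (C[𝕂(t)C]ⁿ)` and **`gSer_eq_tsum_dysonTerm`**: `G(t) = Σ'ₙ dysonTerm (C C) 𝕂(t) n`.

WHAT IS PROVED (0 `sorry`, no `Prop` fact; axioms `propext`, `Classical.choice`, `Quot.sound`).
* §6 `extendCol`, `extendCol_apply`, `extendCol_apply'`, `extendCol_comp`, `extendCol_mem_col`, `comp_mem_col`, `coefOf_extendCol`,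
  `mem_act_extendCol_iff`, `lposOf_extendCol`, `ampMatZ_extendCol`, `kerMatZ_extendCol`, **`AMat_map`**, **`KMat_map`**.
* §7 `ANat`, `KNat`, `map_univ_enum`, **`AMat_eq_ANat_card`**, `KMat_eq_KNat_card`, `legsOf_fin_zero`, `ANat_zero`, `KNat_zero`,
  **`ANat_eq`**.
* §8 `aSer`, `kSer`, `gSer`, `coeff_aSer`, `coeff_kSer`, `factorial_inv_mul_choose`, **`aSer_eq`**, **`eq121_gSer`**, **`coeff_gSer`**,
  `factorial_smul_coeff_gSer`.
* §8′ `legMat`, `kerMat_eq_sum_legMat`, `kerIdx`, **`OnePIGraph`**, `gDeg`, `gAmp`, `gDeg_ne_zero`, `finite_gDeg_eq`, `toFinset_gDeg_eq`,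
  `sum_kerIdx_gAmp`, **`kSer_eq_sigmaSeries`**, **`gSer_eq_greenSeries`**, **`coeff_gSer_eq_sum_dysonTerm`**,
  **`gSer_eq_tsum_dysonTerm`**.
HONEST SCOPE.  (i) Pure finite algebra/combinatorics and formal power series over a commutative `ℚ`-algebra of scalars `R`
(the `1/n!` of the exponential generating function); `C` any SYMMETRIC matrix on a finite position type `S`; one
order-counting variable `t` (the number of vertices) — print's orders in `e, λ` are a regrading of the same sums by the
vertex types (`coef`), not done here.  (ii) `X = 𝕂(t)` is the WHOLE labelled amputated 1PI insertion; print's split into the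
five letters `−δm² + Σ^ε + ∂^{ε*}Σ^ε_1 + Σ^{ε*}_1∂^ε + ∂^{ε*}Σ^ε_2∂^ε` (by vertex type / derivative legs) is a partition of `ι`
(p32 `sigmaSeries_sum`), not performed here.  (iii) Labelled throughout (no symmetry factors); the identification with BRICK 5's
`t`-derivatives of the regularized two-point function at `e = 0` is FILE 4; nothing about estimates or `ε → 0`.  (iv) All
declarations extend FILE 2's `VertexData` namespace (dot notation), per CONVENTIONS §2.
-/

namespace Literature.MathematicalPhysics.QuantumFieldTheory.Balaban1983to89

open Finset Literature.Probability.LatticeModels B3Eq121FirstBlock B3Eq121LabelledChains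

namespace B3Eq121LabelledChains.VertexData

/-! ## §6 Relabelling the vertices: `𝔸(U)` and `𝕂(U)` depend on `U` only through `|U|` -/

section Relabel

variable {W : Type*} {W' : Type*} {κ : Type*} {S : Type*} {R : Type*} {D : ℕ} {𝓥 : VertexData κ S R D}

/-- EXTENDING a colouring along an embedding of vertex types (spare colour off the image). [cite: Balaban1983Higgs3, (1.21) p.416] -/
noncomputable def extendCol (𝓥 : VertexData κ S R D) (ψ : W ↪ W') (z : W → κ) : W' → κ :=
  Function.extend ψ z fun _ => 𝓥.c₀

/-- kernel: the extension agrees with the colouring on the image. [cite: Balaban1983Higgs3, (1.21) p.416] -/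
theorem extendCol_apply (ψ : W ↪ W') (z : W → κ) (v : W) : 𝓥.extendCol ψ z (ψ v) = z v :=
  ψ.injective.extend_apply _ _ _

/-- kernel: the extension is the spare colour off the image. [cite: Balaban1983Higgs3, (1.21) p.416] -/
theorem extendCol_apply' (ψ : W ↪ W') (z : W → κ) {v' : W'} (hv' : ∀ v, ψ v ≠ v') : 𝓥.extendCol ψ z v' = 𝓥.c₀ :=
  Function.extend_apply' _ _ _ fun ⟨v, hv⟩ => hv' v hv

/-- kernel: a colouring of `U.map ψ` is the extension of its restriction along `ψ`. [cite: Balaban1983Higgs3, (1.21) p.416] -/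
theorem extendCol_comp [Fintype W'] [DecidableEq W'] [DecidableEq κ] (ψ : W ↪ W') {U : Finset W} {z' : W' → κ}
    (hz' : z' ∈ 𝓥.col (U.map ψ)) : 𝓥.extendCol ψ (z' ∘ ψ) = z' := by
  funext v'
  by_cases h : ∃ v, ψ v = v'
  · obtain ⟨v, rfl⟩ := h
    exact extendCol_apply ψ _ v
  · rw [extendCol_apply' ψ _ fun v hv => h ⟨v, hv⟩]
    exact ((mem_col.1 hz').2 v' fun hv' => h (by obtain ⟨v, -, hv⟩ := mem_map.1 hv'; exact ⟨v, hv⟩)).symm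

/-- kernel: extending a colouring of `U` gives a colouring of `U.map ψ`. [cite: Balaban1983Higgs3, (1.21) p.416] -/
theorem extendCol_mem_col [Fintype W] [DecidableEq W] [Fintype W'] [DecidableEq W'] [DecidableEq κ] (ψ : W ↪ W')
    {U : Finset W} {z : W → κ} (hz : z ∈ 𝓥.col U) : 𝓥.extendCol ψ z ∈ 𝓥.col (U.map ψ) := by
  rw [mem_col] at hz ⊢
  refine ⟨fun v' hv' => ?_, fun v' hv' => ?_⟩
  · obtain ⟨v, hv, rfl⟩ := mem_map.1 hv'
    rw [extendCol_apply]; exact hz.1 v hv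
  · by_cases h : ∃ v, ψ v = v'
    · obtain ⟨v, rfl⟩ := h
      rw [extendCol_apply]
      exact hz.2 v fun hv => hv' (mem_map_of_mem _ hv)
    · exact extendCol_apply' ψ z fun v hv => h ⟨v, hv⟩

/-- kernel: restricting a colouring of `U.map ψ` along `ψ` gives a colouring of `U`. [cite: Balaban1983Higgs3, (1.21) p.416] -/
theorem comp_mem_col [Fintype W] [DecidableEq W] [Fintype W'] [DecidableEq W'] [DecidableEq κ] (ψ : W ↪ W') {U : Finset W}
    {z' : W' → κ} (hz' : z' ∈ 𝓥.col (U.map ψ)) : z' ∘ ψ ∈ 𝓥.col U := by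
  rw [mem_col] at hz' ⊢
  refine ⟨fun v hv => hz'.1 _ (mem_map_of_mem _ hv), fun v hv => hz'.2 _ fun h => hv ?_⟩
  rwa [mem_map' ψ] at h

/-- kernel: coefficients are invariant under relabelling. [cite: Balaban1983Higgs3, (1.21) p.416] -/
theorem coefOf_extendCol [CommRing R] (ψ : W ↪ W') (z : W → κ) (U : Finset W) :
    𝓥.coefOf (U.map ψ) (𝓥.extendCol ψ z) = 𝓥.coefOf U z := by
  rw [coefOf, coefOf, prod_map]
  exact prod_congr rfl fun v _ => by rw [extendCol_apply]

variable [Fintype W] [DecidableEq W] [Fintype W'] [DecidableEq W'] [DecidableEq S] [CommRing R] {C : Matrix S S R}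

omit [DecidableEq W] [DecidableEq W'] [DecidableEq S] [CommRing R] in
/-- kernel: the active legs of an extended colouring over the image are the images of the active legs.
[cite: Balaban1983Higgs3, (1.21) p.416] -/
theorem mem_act_extendCol_iff (ψ : W ↪ W') (z : W → κ) (U : Finset W) (l' : W' × Fin D) (hl' : l'.1 ∈ U.map ψ) :
    l' ∈ 𝓥.act (𝓥.extendCol ψ z) ↔ l' ∈ (𝓥.act z).map (ψ.prodMap (Function.Embedding.refl (Fin D))) := by
  obtain ⟨v', i⟩ := l'
  obtain ⟨v, -, rfl⟩ := mem_map.1 hl'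
  simp only [act, mem_filter, mem_univ, true_and, mem_map, extendCol_apply, Function.Embedding.prodMap,
    Function.Embedding.coeFn_mk, Prod.exists, Prod.map, Function.Embedding.refl_apply, Prod.mk.injEq]
  constructor
  · intro h; exact ⟨v, i, h, rfl, rfl⟩
  · rintro ⟨v₁, i₁, h, hv₁, rfl⟩; rw [ψ.injective hv₁] at h; exact h

omit [Fintype W] [DecidableEq W] [Fintype W'] [DecidableEq W'] [DecidableEq S] [CommRing R] in
/-- kernel: leg positions are invariant under relabelling. [cite: Balaban1983Higgs3, (1.21) p.416] -/
theorem lposOf_extendCol (ψ : W ↪ W') (z : W → κ) (l : W × Fin D) :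
    𝓥.lposOf (𝓥.extendCol ψ z) (ψ.prodMap (Function.Embedding.refl (Fin D)) l) = 𝓥.lposOf z l := by
  simp only [lposOf, Function.Embedding.prodMap, Function.Embedding.coeFn_mk, Prod.map_fst, Prod.map_snd,
    Function.Embedding.refl_apply, extendCol_apply]

/-- kernel: the per-colouring connected matrix is invariant under relabelling the vertices. [cite: Balaban1983Higgs3, (1.21) p.416] -/
theorem ampMatZ_extendCol (hC : C.IsSymm) (ψ : W ↪ W') (z : W → κ) (U : Finset W) :
    𝓥.ampMatZ C (𝓥.extendCol ψ z) (U.map ψ) = 𝓥.ampMatZ C z U := by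
  unfold ampMatZ
  rw [ampMat_congr (mem_act_extendCol_iff ψ z U) (fun P _ => rfl) (fun l _ => rfl)]
  exact ampMat_map (ψ.prodMap (Function.Embedding.refl (Fin D))) ψ (fun l => rfl)
    (fun P => pw_map hC _ (lposOf_extendCol ψ z) P) (lposOf_extendCol ψ z) U

/-- kernel: the per-colouring 1PI matrix is invariant under relabelling the vertices. [cite: Balaban1983Higgs3, (1.21) p.416] -/
theorem kerMatZ_extendCol (hC : C.IsSymm) (ψ : W ↪ W') (z : W → κ) (U : Finset W) :
    𝓥.kerMatZ C (𝓥.extendCol ψ z) (U.map ψ) = 𝓥.kerMatZ C z U := by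
  unfold kerMatZ
  rw [kerMat_congr (mem_act_extendCol_iff ψ z U) (fun P _ => rfl) (fun l _ => rfl)]
  exact kerMat_map (ψ.prodMap (Function.Embedding.refl (Fin D))) ψ (fun l => rfl)
    (fun P => pw_map hC _ (lposOf_extendCol ψ z) P) (lposOf_extendCol ψ z) U

variable [DecidableEq κ]

/-- **RELABELLING INVARIANCE of `𝔸`**: `𝔸_{W'}(ψ(U)) = 𝔸_W(U)` for an embedding `ψ : W ↪ W'` of vertex types — the labelled
colour-summed matrices depend on the vertex set only up to bijection. [cite: Balaban1983Higgs3, (1.21) p.416] -/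
theorem AMat_map (hC : C.IsSymm) (ψ : W ↪ W') (U : Finset W) : 𝓥.AMat C (U.map ψ) = 𝓥.AMat C U := by
  unfold AMat
  refine sum_nbij' (fun z' => z' ∘ ψ) (fun z => 𝓥.extendCol ψ z) (fun z' hz' => comp_mem_col ψ hz')
    (fun z hz => extendCol_mem_col ψ hz) (fun z' hz' => extendCol_comp ψ hz') (fun z _ => ?_) (fun z' hz' => ?_)
  · funext v; exact extendCol_apply ψ z v
  · conv_lhs => rw [← extendCol_comp ψ hz']
    rw [ampMatZ_extendCol hC, coefOf_extendCol]

/-- **RELABELLING INVARIANCE of `𝕂`**. [cite: Balaban1983Higgs3, (1.21) p.416] -/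
theorem KMat_map (hC : C.IsSymm) (ψ : W ↪ W') (U : Finset W) : 𝓥.KMat C (U.map ψ) = 𝓥.KMat C U := by
  unfold KMat
  refine sum_nbij' (fun z' => z' ∘ ψ) (fun z => 𝓥.extendCol ψ z) (fun z' hz' => comp_mem_col ψ hz')
    (fun z hz => extendCol_mem_col ψ hz) (fun z' hz' => extendCol_comp ψ hz') (fun z _ => ?_) (fun z' hz' => ?_)
  · funext v; exact extendCol_apply ψ z v
  · conv_lhs => rw [← extendCol_comp ψ hz']
    rw [kerMatZ_extendCol hC, coefOf_extendCol]

end Relabel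

/-! ## §7 On `n` labelled vertices: the BINOMIAL last-block recursion -/

section Card

variable {κ : Type*} {S : Type*} {R : Type*} {D : ℕ} [DecidableEq κ] [DecidableEq S] [CommRing R]
  (𝓥 : VertexData κ S R D) (C : Matrix S S R)

/-- **`𝔸ₙ`**: the colour-summed amputated CONNECTED two-point matrix on `n` labelled vertices (all labelled connected
two-point graphs of (1.19)/(1.20) with exactly `n` vertices, every vertex summed over its types, sites and indices, external
propagators stripped). [cite: Balaban1983Higgs3, (1.21) p.416] -/
noncomputable def ANat (n : ℕ) : Matrix S S R := 𝓥.AMat C (univ : Finset (Fin n))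

/-- **`𝕂ₙ`**: the colour-summed amputated ONE-PARTICLE-IRREDUCIBLE two-point matrix on `n` labelled vertices (the order-`n`
labelled self-energy insertion). [cite: Balaban1983Higgs3, (1.21) p.416] -/
noncomputable def KNat (n : ℕ) : Matrix S S R := 𝓥.KMat C (univ : Finset (Fin n))

variable {𝓥 C}

/-- kernel: an enumeration `Fin |U| ↪ W` of a finite set `U`. [folklore] [cite: Balaban1983Higgs3, (1.21) p.416] -/
theorem map_univ_enum {W : Type*} (U : Finset W) :
    (univ : Finset (Fin U.card)).map (U.equivFin.symm.toEmbedding.trans (Function.Embedding.subtype _)) = U := by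
  ext v
  simp only [mem_map, mem_univ, true_and, Function.Embedding.trans_apply, Equiv.coe_toEmbedding,
    Function.Embedding.coe_subtype]
  constructor
  · rintro ⟨i, rfl⟩; exact (U.equivFin.symm i).2
  · intro hv; exact ⟨U.equivFin ⟨v, hv⟩, by rw [Equiv.symm_apply_apply]⟩

/-- **`𝔸(U) = 𝔸_{|U|}`**: the colour-summed connected matrix of a vertex set depends only on its cardinality.
[cite: Balaban1983Higgs3, (1.21) p.416] -/
theorem AMat_eq_ANat_card {W : Type*} [Fintype W] [DecidableEq W] (hC : C.IsSymm) (U : Finset W) :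
    𝓥.AMat C U = 𝓥.ANat C U.card := by
  rw [ANat, ← AMat_map hC (U.equivFin.symm.toEmbedding.trans (Function.Embedding.subtype _)), map_univ_enum]

/-- **`𝕂(U) = 𝕂_{|U|}`**. [cite: Balaban1983Higgs3, (1.21) p.416] -/
theorem KMat_eq_KNat_card {W : Type*} [Fintype W] [DecidableEq W] (hC : C.IsSymm) (U : Finset W) :
    𝓥.KMat C U = 𝓥.KNat C U.card := by
  rw [KNat, ← KMat_map hC (U.equivFin.symm.toEmbedding.trans (Function.Embedding.subtype _)), map_univ_enum]

omit [DecidableEq κ] [DecidableEq S] [CommRing R] in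
/-- kernel: no vertices, no legs: the per-colouring matrices on `Fin 0` vanish. [cite: Balaban1983Higgs3, (1.21) p.416] -/
theorem legsOf_fin_zero (z : Fin 0 → κ) : legsOf Prod.fst (𝓥.act z) (univ : Finset (Fin 0)) = ∅ :=
  eq_empty_of_forall_notMem fun l _ => l.1.elim0

/-- `𝔸₀ = 0` (a two-point graph has at least its two external legs' vertices… here: no vertex, no leg).
[cite: Balaban1983Higgs3, (1.21) p.416] -/
theorem ANat_zero : 𝓥.ANat C 0 = 0 := by
  unfold ANat AMat
  refine sum_eq_zero fun z _ => ?_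
  rw [ampMatZ, ampMat, legsOf_fin_zero]
  ext p q
  simp [posMat]

/-- `𝕂₀ = 0`. [cite: Balaban1983Higgs3, (1.21) p.416] -/
theorem KNat_zero : 𝓥.KNat C 0 = 0 := by
  unfold KNat KMat
  refine sum_eq_zero fun z _ => ?_
  rw [kerMatZ, kerMat, legsOf_fin_zero]
  ext p q
  simp [posMat]

variable [Fintype S]

/-- **THE BINOMIAL LAST-BLOCK RECURSION** `𝔸ₙ = 𝕂ₙ + Σ_{j ≤ n} C(n, j) · 𝔸_{n−j} · C · 𝕂_j`: choose the `j` labelled vertices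
of the last one-particle-irreducible piece. [cite: Balaban1983Higgs3, (1.21) p.416] -/
theorem ANat_eq (hC : C.IsSymm) (n : ℕ) :
    𝓥.ANat C n = 𝓥.KNat C n + ∑ j ∈ range (n + 1), (n.choose j) • (𝓥.ANat C (n - j) * C * 𝓥.KNat C j) := by
  have h := AMat_eq (𝓥 := 𝓥) hC (univ : Finset (Fin n))
  have hB : ∀ B ∈ (univ : Finset (Fin n)).powerset,
      𝓥.AMat C (univ \ B) * C * 𝓥.KMat C B = 𝓥.ANat C (n - B.card) * C * 𝓥.KNat C B.card := fun B _ => by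
    rw [AMat_eq_ANat_card hC, KMat_eq_KNat_card hC, card_univ_sdiff, Fintype.card_fin]
  rw [sum_congr rfl hB, Finset.sum_powerset_apply_card (fun j => 𝓥.ANat C (n - j) * C * 𝓥.KNat C j), card_univ,
    Fintype.card_fin] at h
  exact h

end Card

/-! ## §8 The exponential generating functions: the chain equation, r15's `Eq121`, p32's `greenSeries` and Dyson series -/

section EGF

open scoped Nat

variable {κ : Type*} {S : Type*} {R : Type*} {D : ℕ} [DecidableEq κ] [Fintype S] [DecidableEq S] [CommRing R] [Algebra ℚ R]
  (𝓥 : VertexData κ S R D) (C : Matrix S S R)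

/-- **The exponential generating function `𝔸(t) = Σₙ tⁿ/n! · 𝔸ₙ`** of the labelled amputated connected two-point matrices
(a formal power series in one order-counting variable with matrix coefficients). [cite: Balaban1983Higgs3, (1.21) p.416] -/
noncomputable def aSer : PowerSeries (Matrix S S R) := PowerSeries.mk fun n => ((n ! : ℚ)⁻¹) • 𝓥.ANat C n

/-- **The exponential generating function `𝕂(t) = Σₙ tⁿ/n! · 𝕂ₙ`** of the labelled amputated 1PI matrices — the SELF-ENERGY
series, print's insertion `(−δm² + Σ^ε + ∂^{ε*}Σ^ε_1 + Σ^{ε*}_1∂^ε + ∂^{ε*}Σ^ε_2∂^ε)` before its split into five letters.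
[cite: Balaban1983Higgs3, (1.21) p.416] -/
noncomputable def kSer : PowerSeries (Matrix S S R) := PowerSeries.mk fun n => ((n ! : ℚ)⁻¹) • 𝓥.KNat C n

/-- **The two-point series `G(t) = C + C · 𝔸(t) · C`**: free propagator plus all labelled connected two-point graphs with their
external propagators. [cite: Balaban1983Higgs3, (1.21) p.416] -/
noncomputable def gSer : PowerSeries (Matrix S S R) :=
  PowerSeries.C C + PowerSeries.C C * 𝓥.aSer C * PowerSeries.C C

variable {𝓥 C}

/-- [cite: Balaban1983Higgs3, (1.21) p.416] -/
@[simp] theorem coeff_aSer (n : ℕ) : PowerSeries.coeff n (𝓥.aSer C) = ((n ! : ℚ)⁻¹) • 𝓥.ANat C n := by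
  rw [aSer, PowerSeries.coeff_mk]

/-- [cite: Balaban1983Higgs3, (1.21) p.416] -/
@[simp] theorem coeff_kSer (n : ℕ) : PowerSeries.coeff n (𝓥.kSer C) = ((n ! : ℚ)⁻¹) • 𝓥.KNat C n := by
  rw [kSer, PowerSeries.coeff_mk]

/-- kernel: `1/n! · C(n, j) = 1/(n−j)! · 1/j!`. [folklore] [cite: Balaban1983Higgs3, (1.21) p.416] -/
theorem factorial_inv_mul_choose {n j : ℕ} (hj : j ≤ n) :
    ((n ! : ℚ)⁻¹ * (n.choose j : ℚ)) = (((n - j) ! : ℚ)⁻¹ * ((j ! : ℚ)⁻¹)) := by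
  have h1 : (j ! : ℚ) ≠ 0 := by exact_mod_cast (Nat.factorial_pos j).ne'
  have h2 : ((n - j) ! : ℚ) ≠ 0 := by exact_mod_cast (Nat.factorial_pos (n - j)).ne'
  have h3 : (n ! : ℚ) ≠ 0 := by exact_mod_cast (Nat.factorial_pos n).ne'
  rw [Nat.cast_choose ℚ hj]
  field_simp

/-- **THE CHAIN EQUATION `𝔸(t) = 𝕂(t) + 𝔸(t) · C · 𝕂(t)`** for the exponential generating functions (the binomial last-block
recursion `ANat_eq`, divided by `n!`): a connected two-point graph is a CHAIN of 1PI pieces joined by single lines `C`.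
[cite: Balaban1983Higgs3, (1.21) p.416] -/
theorem aSer_eq (hC : C.IsSymm) : 𝓥.aSer C = 𝓥.kSer C + 𝓥.aSer C * PowerSeries.C C * 𝓥.kSer C := by
  refine PowerSeries.ext fun n => ?_
  rw [map_add, PowerSeries.coeff_mul, ← Finset.Nat.sum_antidiagonal_swap]
  simp only [Prod.fst_swap, Prod.snd_swap]
  rw [Finset.Nat.sum_antidiagonal_eq_sum_range_succ
      (fun i j => PowerSeries.coeff j (𝓥.aSer C * PowerSeries.C C) * PowerSeries.coeff i (𝓥.kSer C)) n]
  simp only [PowerSeries.coeff_mul_C, coeff_aSer, coeff_kSer, Matrix.smul_mul, Matrix.mul_smul, smul_smul]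
  rw [ANat_eq hC n, smul_add, smul_sum]
  congr 1
  refine sum_congr rfl fun j hj => ?_
  rw [← Nat.cast_smul_eq_nsmul ℚ, smul_smul, factorial_inv_mul_choose (Nat.lt_succ_iff.mp (mem_range.mp hj)), mul_comm]

/-- **r15's (1.21) BY NAME**: the two-point series satisfies the resummed Dyson equation `B3Sect1TwoPoint.Eq121 G C₀ X`,
`G = C₀ + G · X · C₀`, with `C₀ = C` (constant series) and the insertion `X = 𝕂(t)` the exponential generating function of the
labelled amputated 1PI matrices. [cite: Balaban1983Higgs3, (1.21) p.416] -/
theorem eq121_gSer (hC : C.IsSymm) : B3Sect1TwoPoint.Eq121 (𝓥.gSer C) (PowerSeries.C C) (𝓥.kSer C) := by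
  have h := aSer_eq (𝓥 := 𝓥) hC
  unfold B3Sect1TwoPoint.Eq121 gSer
  calc PowerSeries.C C + PowerSeries.C C * 𝓥.aSer C * PowerSeries.C C
      = PowerSeries.C C + PowerSeries.C C * (𝓥.kSer C + 𝓥.aSer C * PowerSeries.C C * 𝓥.kSer C) * PowerSeries.C C := by
        rw [← h]
    _ = _ := by noncomm_ring

/-- **The coefficients of the two-point series**: `coeff₀ G = C` and `coeffₙ G = 1/n! · C · 𝔸ₙ · C` — order by order, the free
propagator plus the amputated connected graphs with `n` vertices dressed with their two external propagators.
[cite: Balaban1983Higgs3, (1.21) p.416] -/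
theorem coeff_gSer (n : ℕ) :
    PowerSeries.coeff n (𝓥.gSer C) = (if n = 0 then C else 0) + ((n ! : ℚ)⁻¹) • (C * 𝓥.ANat C n * C) := by
  simp only [gSer, map_add, PowerSeries.coeff_C, PowerSeries.coeff_mul_C, PowerSeries.coeff_C_mul, coeff_aSer,
    Matrix.smul_mul, Matrix.mul_smul]

/-- `n! · coeffₙ G = C · 𝔸ₙ · C` for `n ≥ 1`. [cite: Balaban1983Higgs3, (1.21) p.416] -/
theorem factorial_smul_coeff_gSer {n : ℕ} (hn : n ≠ 0) :
    (n ! : ℚ) • PowerSeries.coeff n (𝓥.gSer C) = C * 𝓥.ANat C n * C := by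
  have h3 : (n ! : ℚ) ≠ 0 := by exact_mod_cast (Nat.factorial_pos n).ne'
  rw [coeff_gSer, if_neg hn, zero_add, smul_smul, mul_inv_cancel₀ h3, one_smul]

end EGF

/-! ## §8′ p32's vocabulary BY NAME: `ι :=` the labelled coloured 1PI graphs, `X = sigmaSeries`, `G = greenSeries = Σ' C₀[XC₀]ⁿ` -/

section Graphs

open scoped Nat
open B3Sect1TwoPoint (dysonTerm Eq121)
open B3Eq121OnePIChains

variable {κ : Type*} {S : Type*} {R : Type*} {D : ℕ} [DecidableEq κ]

/-- The single-graph value matrix: the value `x` of ONE labelled amputated two-point graph placed at the positions of its entry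
and exit legs. [cite: Balaban1983Higgs3, (1.21) p.416] -/
def legMat {Λ : Type*} [DecidableEq S] [CommRing R] (pos : Λ → S) (a e : Λ) (x : R) : Matrix S S R :=
  fun p q => if pos a = p then (if pos e = q then x else 0) else 0

/-- kernel: the 1PI matrix is the sum of the single-graph matrices of the labelled 1PI graphs. [cite: Balaban1983Higgs3, (1.21) p.416] -/
theorem kerMat_eq_sum_legMat {Λ : Type*} [DecidableEq Λ] {V : Type*} [DecidableEq V] [DecidableEq S] [CommRing R]
    (own : Λ → V) (A : Finset Λ) (w : Finset Λ → R) (pos : Λ → S) (U : Finset V) :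
    kerMat own A w pos U = ∑ a ∈ legsOf own A U, ∑ e ∈ (legsOf own A U).erase a, ∑ μ ∈ kerSet own A U a e,
      legMat pos a e (∏ P ∈ μ, w P) := by
  ext p q
  simp only [kerMat, posMat, posVec, kerSum, legMat, Matrix.sum_apply]
  refine sum_congr rfl fun a _ => ?_
  split_ifs with hp
  · refine sum_congr rfl fun e _ => ?_
    split_ifs with hq
    · rfl
    · exact sum_const_zero.symm
  · symm
    exact sum_eq_zero fun e _ => sum_const_zero

variable (𝓥 : VertexData κ S R D)

/-- **The labelled coloured ONE-PARTICLE-IRREDUCIBLE two-point graphs on `n` vertices**: a colouring `z` of the `n` vertices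
(types, sites, indices), an entry leg `a`, an exit leg `e ≠ a`, and a one-particle-irreducible perfect pairing `μ` of the
remaining active legs. [cite: Balaban1983Higgs3, (1.21) p.416] -/
def kerIdx (n : ℕ) :
    Finset ((_ : (_ : (_ : Fin n → κ) × (Fin n × Fin D)) × (Fin n × Fin D)) × Finset (Finset (Fin n × Fin D))) :=
  (((𝓥.col (univ : Finset (Fin n))).sigma fun z => legsOf Prod.fst (𝓥.act z) (univ : Finset (Fin n))).sigma
      fun x => (legsOf Prod.fst (𝓥.act x.1) univ).erase x.2).sigma
    fun x => kerSet Prod.fst (𝓥.act x.1.1) univ x.1.2 x.2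

/-- **`ι`: ALL labelled coloured one-particle-irreducible two-point graphs** (graded by their number of vertices `n`) — the
index type of p32's `B3Eq121OnePIChains.sigmaSeries`. [cite: Balaban1983Higgs3, (1.21) p.416] -/
abbrev OnePIGraph : Type _ := Σ n : ℕ, {x // x ∈ 𝓥.kerIdx n}

/-- The ORDER of a 1PI graph: its number of vertices (one order-counting variable). [cite: Balaban1983Higgs3, (1.21) p.416] -/
noncomputable def gDeg (i : 𝓥.OnePIGraph) : Unit →₀ ℕ := Finsupp.single () i.1

variable [DecidableEq S] [CommRing R] [Algebra ℚ R] (C : Matrix S S R)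

/-- The AMPLITUDE of a 1PI graph `i = (n; z, a, e, μ)`: `1/n! · Π_v coef z_v ·` (its amputated value — the product of the
propagators of its lines — placed at the positions of its external legs). [cite: Balaban1983Higgs3, (1.21) p.416] -/
noncomputable def gAmp (i : 𝓥.OnePIGraph) : Matrix S S R :=
  ((i.1 ! : ℚ)⁻¹) • (𝓥.coefOf univ i.2.1.1.1.1 •
    legMat (𝓥.lposOf i.2.1.1.1.1) i.2.1.1.1.2 i.2.1.1.2 (∏ P ∈ i.2.1.2, pw C (𝓥.lposOf i.2.1.1.1.1) P))

variable {𝓥 C}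

omit [DecidableEq S] [CommRing R] [Algebra ℚ R] in
/-- every 1PI graph has positive order (no vertex, no leg, no two-point graph). [cite: Balaban1983Higgs3, (1.21) p.416] -/
theorem gDeg_ne_zero (i : 𝓥.OnePIGraph) : 𝓥.gDeg i ≠ 0 := by
  obtain ⟨n, x⟩ := i
  intro h
  have hn : n = 0 := by simpa [gDeg] using h
  subst hn
  exact x.1.1.1.2.1.elim0

omit [DecidableEq S] [CommRing R] [Algebra ℚ R] in
/-- at each order there are finitely many labelled 1PI graphs. [cite: Balaban1983Higgs3, (1.21) p.416] -/
theorem finite_gDeg_eq (d : Unit →₀ ℕ) : {i : 𝓥.OnePIGraph | 𝓥.gDeg i = d}.Finite := by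
  refine (Set.finite_range fun x : {x // x ∈ 𝓥.kerIdx (d ())} => (⟨d (), x⟩ : 𝓥.OnePIGraph)).subset ?_
  rintro ⟨n, x⟩ h
  have h' : Finsupp.single () n = d := h
  have hn : n = d () := by rw [← h', Finsupp.single_eq_same]
  subst hn
  exact ⟨x, rfl⟩

omit [DecidableEq S] [CommRing R] [Algebra ℚ R] in
/-- kernel: the 1PI graphs of order `m`, as a finite set. [cite: Balaban1983Higgs3, (1.21) p.416] -/
theorem toFinset_gDeg_eq (m : ℕ) :
    (finite_gDeg_eq (𝓥 := 𝓥) (Finsupp.single () m)).toFinset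
      = (univ : Finset {x // x ∈ 𝓥.kerIdx m}).map ⟨Sigma.mk m, sigma_mk_injective⟩ := by
  ext ⟨n, x⟩
  simp only [Set.Finite.mem_toFinset, Set.mem_setOf_eq, mem_map, mem_univ, true_and, Function.Embedding.coeFn_mk]
  constructor
  · intro h
    obtain rfl : n = m := Finsupp.single_injective () h
    exact ⟨x, rfl⟩
  · rintro ⟨y, hy⟩
    cases hy
    rfl

/-- **`𝕂ₘ/m!` is the sum of the amplitudes of the labelled 1PI graphs of order `m`.** [cite: Balaban1983Higgs3, (1.21) p.416] -/
theorem sum_kerIdx_gAmp (m : ℕ) :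
    ∑ x : {x // x ∈ 𝓥.kerIdx m}, 𝓥.gAmp C ⟨m, x⟩ = ((m ! : ℚ)⁻¹) • 𝓥.KNat C m := by
  have h1 : ∑ x : {x // x ∈ 𝓥.kerIdx m}, 𝓥.gAmp C ⟨m, x⟩
      = ∑ y ∈ 𝓥.kerIdx m, ((m ! : ℚ)⁻¹) • (𝓥.coefOf univ y.1.1.1 •
          legMat (𝓥.lposOf y.1.1.1) y.1.1.2 y.1.2 (∏ P ∈ y.2, pw C (𝓥.lposOf y.1.1.1) P)) :=
    Finset.sum_coe_sort (𝓥.kerIdx m) fun y => ((m ! : ℚ)⁻¹) • (𝓥.coefOf univ y.1.1.1 •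
      legMat (𝓥.lposOf y.1.1.1) y.1.1.2 y.1.2 (∏ P ∈ y.2, pw C (𝓥.lposOf y.1.1.1) P))
  rw [h1, ← smul_sum, KNat, KMat, kerIdx, sum_sigma, sum_sigma, sum_sigma]
  congr 1
  refine sum_congr rfl fun z _ => ?_
  rw [kerMatZ, kerMat_eq_sum_legMat, smul_sum]
  refine sum_congr rfl fun a _ => ?_
  rw [smul_sum]
  refine sum_congr rfl fun e _ => ?_
  rw [smul_sum]

variable [Fintype S]

/-- **p32's SELF-ENERGY SERIES BY NAME**: `𝕂(t) = B3Eq121OnePIChains.sigmaSeries gAmp gDeg` — the insertion `X` of (1.21) IS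
the generating series of the labelled coloured amputated one-particle-irreducible two-point graphs, `ι := OnePIGraph`.
[cite: Balaban1983Higgs3, (1.21) p.416] -/
theorem kSer_eq_sigmaSeries : 𝓥.kSer C = sigmaSeries (𝓥.gAmp C) 𝓥.gDeg := by
  refine PowerSeries.ext fun m => ?_
  rw [coeff_kSer, PowerSeries.coeff_def (s := Finsupp.single () m) Finsupp.single_eq_same,
    coeff_sigmaSeries finite_gDeg_eq (Finsupp.single () m), toFinset_gDeg_eq, sum_map]
  simp only [Function.Embedding.coeFn_mk]
  exact (sum_kerIdx_gAmp m).symm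

/-- **p32's TWO-POINT SERIES BY NAME**: `G(t) = B3Eq121OnePIChains.greenSeries C gAmp gDeg` — the two-point series of the
labelled expansion IS the generating series of the CHAINS of labelled 1PI graphs joined by free propagators `C` (uniqueness
of the solution of `Eq121` in formal series, p32 `eq_greenSeries_of_eq121`). [cite: Balaban1983Higgs3, (1.21) p.416] -/
theorem gSer_eq_greenSeries (hC : C.IsSymm) : 𝓥.gSer C = greenSeries C (𝓥.gAmp C) 𝓥.gDeg := by
  refine eq_greenSeries_of_eq121 gDeg_ne_zero finite_gDeg_eq ?_
  rw [← kSer_eq_sigmaSeries]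
  exact eq121_gSer hC

/-- **(1.21) ORDER BY ORDER**: `coeffₘ G = Σ_{n ≤ m} coeffₘ (C [𝕂(t) C]ⁿ)` — at each order the two-point series is the finite
sum of the first terms of the printed Dyson series `Σₙ C^ε_0[X C^ε_0]ⁿ` (r15's `dysonTerm`). [cite: Balaban1983Higgs3, (1.21) p.416] -/
theorem coeff_gSer_eq_sum_dysonTerm (hC : C.IsSymm) (m : ℕ) :
    PowerSeries.coeff m (𝓥.gSer C)
      = ∑ n ∈ range (m + 1), PowerSeries.coeff m (dysonTerm (PowerSeries.C C) (𝓥.kSer C) n) := by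
  have h := coeff_greenSeries_eq_sum_dysonTerm (C0 := C) (amp := 𝓥.gAmp C) gDeg_ne_zero finite_gDeg_eq
    (Finsupp.single () m)
  rw [← gSer_eq_greenSeries hC, ← kSer_eq_sigmaSeries, Finsupp.degree_single] at h
  rw [PowerSeries.coeff_def (s := Finsupp.single () m) Finsupp.single_eq_same]
  exact h

open PowerSeries.WithPiTopology in
/-- **(1.21) LITERALLY, AS PRINTED**: `G = Σ'_{n} C [X C]ⁿ` with `X = 𝕂(t)` the self-energy series of the labelled amputated
1PI graphs — the printed `G^ε = Σ_{n=0}^∞ C^ε_0[(−δm² + Σ^ε + …)C^ε_0]ⁿ` for the labelled Gaussian perturbation expansion, in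
formal series with Hausdorff coefficients. [cite: Balaban1983Higgs3, (1.21) p.416] -/
theorem gSer_eq_tsum_dysonTerm [TopologicalSpace R] [T2Space R] (hC : C.IsSymm) :
    𝓥.gSer C = ∑' n, dysonTerm (PowerSeries.C C) (𝓥.kSer C) n := by
  have h := greenSeries_eq_tsum_dysonTerm (C0 := C) (amp := 𝓥.gAmp C) gDeg_ne_zero finite_gDeg_eq
  rw [← gSer_eq_greenSeries hC, ← kSer_eq_sigmaSeries] at h
  exact h

end Graphs

end B3Eq121LabelledChains.VertexData

end Literature.MathematicalPhysics.QuantumFieldTheory.Balaban1983to89
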